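import Summits.BirchSwinnertonDyer.Rank1Residual.X2.GreenbergVatsalStrictAtPQuotient
import HarnessLib

/-!
# Greenberg's local condition at `p` over `ℚ_∞^{cyc}`: the INERTIA form equals the STRICT
# (decomposition-group) form, in the kernel — `H¹(G_𝔭/I_𝔭, Ẽ[p^∞]) = 0` for Greenberg's datum

HONEST FRAMING (cell `b2b-bsdres`, run/shared/lean/b2b/bsd-rank1-residual/, verbatim in every
file): the goal of the cell is to DELETE the COMBINATION-SHAPED residual classes of the
Birch–Swinnerton-Dyer formula for ALL analytic-rank `≤ 1` elliptic curves over `ℚ` — "full BSD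
formula for every rank `≤ 1` curve in class `C`" assembled STRICTLY from published theorems — so
that the rank-`≤ 1` remainder becomes exactly the CONSTRUCTION-SHAPED classes, which are TYPED
(missing-input `Prop`s), NOT attempted. This is not "finishing BSD". Sub-cell
`b2b-bsdres-eisenstein-p2` (CLASS-OWNERS row "X2"), gen 10: research route; NO CLAIM BEYOND STATED
CLASSES; nothing here changes a label. THEOREMS ONLY (no `def`, no named fact, nothing asserted).

WHY. The cell's identification `Sel_{p^∞}(E/ℚ_∞) = S^{Σ₀}_{E[p^∞]}(ℚ_∞) ⊓ (Kummer at Σ₀)`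
(`GreenbergVatsalSelmerEqualityCited`) rests on ONE printed local statement at the prime above `p`:
`L_𝔭 ⊆ im κ_𝔭` (Literature fact `GreenbergVatsal2000.imKummer_ge_greenbergCondition_at_p`, GV 2000
p. 26 "In [Gre99], one can find a proof that `im(κ_𝔭) = L_𝔭`"). GV's `L_𝔭` is the INERTIA-form
condition `ker(H¹((ℚ_∞)_𝔭, A) → H¹(I_𝔭, D))` (p. 16; the tree's `LocalDatum.greenbergKer`), whereas
what Greenberg proves (LNM 1716 Props. 2.2, 2.4, pp. 73–75) is about the DECOMPOSITION-form
condition `Im λ_K = ker(H¹(K, E[p^∞]) → H¹(K, Ẽ[p^∞]))`, `K = (ℚ_∞)_𝔭` (the tree's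
`LocalDatum.strictKer`, Greenberg 1989's "strict" condition). This file PROVES in the kernel that
the two conditions COINCIDE for Greenberg's datum `C_p = ker(E[p^∞] → Ẽ)` of a good ordinary `p`
over `ℚ_∞^{cyc}` (**`greenbergKer_eq_strictKer`**), so that the cited input is exactly Greenberg's
printed propositions (plus the injectivity of `H¹(K, Ẽ[p^∞]) → H¹(K, Ẽ(𝔽̄_p))`, loc. cit. p. 74).
The mathematics is Greenberg's remark (p. 73) "`E[p^∞]/C_v` is the maximal unramified quotient of
`E[p^∞]`" together with `H¹(G_𝔭/I_𝔭, D) = D/(Frob − 1)D = 0`: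

* (sibling `GreenbergVatsalStrictAtPQuotient`, §1) `D_v` is profinite (closed in `Γ_ℚ`); LOCAL Frobenius generation pushed into `D_v`
  (`exists_eq_frob_pow_mul_of_decomp` ← `LocalFrobeniusGenerationProofs`, `inertia_eq_absInertia`).
* (ibid. §2) the cyclotomic tower at `v ∋ p`: `κ(I_v) = Gal(ℚ_∞/ℚ)` (`exists_mem_inertia_kappa_eq` ←
  `χ_p(I_{𝔓₀}) = ℤ_pˣ`, tree `exists_mem_inertia_cyclotomicCharacter_eq`), hence inertia fills
  every layer (`exists_layer_le_kappa_inertia`: deep values of `κ` are values on `U ∩ I_v` for any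
  open normal `U ≤ D_v`, by `[I_v : I_v ∩ U]`-th powers).
* (ibid. §3) the unramified quotient `D = E[p^∞]/C_p` as a `D_v`-module: continuous orbits, `I_v` acts
  trivially (gen 9 `reductionDatum_htriv`), the Frobenius-fixed points are FINITE
  (`finite_fixed_frob` ← `exists_finset_localRed_smul_frobenius`: "`Ẽ(𝔽_p)` is finite"), `D[p^k]`
  is finite (`finite_torsionBy_gr` ← `localRed_ordinary_filtration`: `red` maps `E[p^k]` onto
  `Ẽ[p^k]`, Silverman III.6.4), `D` is `p`-divisible and `p`-primary; hence **`Frob − 1` is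
  SURJECTIVE on `D`** (`exists_frob_smul_sub_eq` ← `GreenbergVatsalStrictCore.surjective_of_finite_ker_of_divisible`).
* §4 (this file) **`greenbergKer_le_strictKer`** / **`greenbergKer_eq_strictKer`**: with the local Frobenius
  `τ ∈ Γ_{ℚ_v}` fixing `μ_{p^∞}` (so `res τ ∈ Gal(ℚ̄/ℚ_∞)`: `ℚ_∞/ℚ` is totally ramified at `p`, tree
  `ZpExtension.IsCyclotomic.exists_isArithFrobAt_resGal_mem_kerSubgroup`), the abstract theorem
  `GreenbergVatsalStrictCore.exists_eq_smul_sub_of_vanishing_on_inertia_of_surjective` applied to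
  `G = D_v`, `I = I_v`, `P = Gal(ℚ̄/ℚ_∞) ∩ D_v`, `D = E[p^∞]/C_p`.

References: Greenberg, LNM 1716 (1999) §2 pp. 73–75 (C_v, Props. 2.2, 2.4), §3 p. 89;
Greenberg, Adv. Stud. Pure Math. 17 (1989) p. 98 ((4), "strict"); Greenberg–Vatsal (2000) §2
pp. 16, 26; Serre, *Local Fields* XIII §1; Washington, *Cyclotomic Fields* §13.1.
-/

noncomputable section

open scoped Classical NNReal

universe u

namespace Summit.BirchSwinnertonDyer.Rank1Residual.X2.GreenbergVatsalStrictAtP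

open NumberField IsDedekindDomain Field Literature.NumberTheory.GaloisRepresentations
  Literature.NumberTheory.EllipticCurves Literature.NumberTheory.EllipticCurves.GreenbergSelmer
  Literature.NumberTheory.EllipticCurves.ResKernel
  Summit.BirchSwinnertonDyer.Rank1Residual.X2.GreenbergVatsalTorsion
  Summit.BirchSwinnertonDyer.Rank1Residual.X2.GreenbergVatsalReductionDatum
  Summit.BirchSwinnertonDyer.Rank1Residual.X2.GreenbergVatsalStrictCore

open Summit.BirchSwinnertonDyer.Rank1Residual.X2.GreenbergVatsalStrictAtPQuotient

/-! ## §4. Greenberg's condition ⇒ the strict condition at `p` over `ℚ_∞^{cyc}` -/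

section Main

variable (W : WeierstrassCurve ℚ) [W.IsGloballyMinimal] [W.IsElliptic] (p : ℕ) [hp : Fact p.Prime]
  (κ : ZpExtension ℚ p) {v : HeightOneSpectrum (𝓞 ℚ)}

/-- **At the prime of `ℚ_∞` above a good ORDINARY `p`, Greenberg's INERTIA-form local condition
implies the STRICT (decomposition-group) condition, for Greenberg's datum `C_p = ker(E[p^∞] → Ẽ)`:
`greenbergKer ≤ strictKer`** (the converse `strictKer ≤ greenbergKer` is the tree's tautology
`LocalDatum.strictKer_le_greenbergKer`). Over the cyclotomic tower the decomposition group of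
`ℚ_{∞,𝔭}` contains a Frobenius (`ZpExtension.IsCyclotomic.exists_isArithFrobAt_resGal_mem_kerSubgroup`:
`ℚ_∞/ℚ` is totally ramified at `p`), is generated by it and inertia
(`exists_eq_frob_pow_mul_of_decomp`), inertia fills every layer (`exists_layer_le_kappa_inertia`),
and `Frob − 1` is surjective on the unramified quotient `D = Ẽ[p^∞]` (`exists_frob_smul_sub_eq`);
so a class dying in `H¹(H ⊓ I_p, D)` dies in `H¹(H ⊓ D_p, D)`
(`GreenbergVatsalStrictCore.exists_eq_smul_sub_of_vanishing_on_inertia_of_surjective`). This is the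
step between GV's `L_𝔭 = ker(H¹((ℚ_∞)_𝔭, A) → H¹(I_𝔭, D))` (p. 16) and Greenberg's
`Im λ = ker(H¹(K, E[p^∞]) → H¹(K, Ẽ[p^∞]))` (LNM 1716 Prop. 2.2, p. 74), now a kernel theorem.
[cite: GreenbergLNM1716, §2 pp. 73–74] [cite: GreenbergVatsal2000, §2 pp. 16, 26] -/
theorem greenbergKer_le_strictKer (hκ : κ.IsCyclotomic) (hpv : ((p : ℕ) : 𝓞 ℚ) ∈ v.asIdeal)
    (hΔ : ¬ (p : ℤ) ∣ W.minimalDiscriminantInt) (hord : ¬ (p : ℤ) ∣ W.frobeniusTrace p) :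
    (reductionDatum W p hpv hΔ).greenbergKer κ.kerSubgroup ≤
      (reductionDatum W p hpv hΔ).strictKer κ.kerSubgroup := by
  intro c hc
  obtain ⟨f, rfl⟩ :=
    oneCocycleClass_surjective (discreteTopRep κ.kerSubgroup (W.geomPrimaryTorsion p)) c
  obtain ⟨q, hq⟩ := (GreenbergVatsalSelmerLink.oneCocycleClass_mem_greenbergKer_iff κ.kerSubgroup _
    (reductionDatum W p hpv hΔ) f).1 hc
  rw [LocalDatum.mem_strictKer_iff, LocalDatum.strictMap, resH1Hom_oneCocycleClass,
    oneCocycleClass_eq_zero_iff]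
  -- the local Frobenius inside `H`
  obtain ⟨𝔐, h𝔐⟩ := v.localPrimesAbove_nonempty
  have hϖ := IsDedekindDomain.HeightOneSpectrum.irreducible_natCast_adicCompletionIntegers_rat hpv
  obtain ⟨τ, hτ, hτH⟩ := hκ.exists_isArithFrobAt_resGal_mem_kerSubgroup (specVal_spec v) h𝔐 hpv hϖ
  set φ₀ : decomp (K := ℚ) v := ⟨absGaloisRestrict ℚ (v.adicCompletion ℚ) τ, ⟨τ, rfl⟩⟩ with hφ₀
  have hφ₀P : φ₀ ∈ decompIn κ.kerSubgroup v := by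
    rw [mem_decompIn_iff]
    change absGaloisRestrict ℚ (v.adicCompletion ℚ) τ ∈ κ.kerSubgroup
    rw [← WeierstrassCurve.resGal_eq_absGaloisRestrict]; exact hτH
  -- dictionaries
  have hDeq : decomp v = (adicCompletionPrime ℚ v).decompositionSubgroup (absoluteGaloisGroup ℚ) :=
    (decompositionSubgroup_adicCompletionPrime_eq_range ℚ v).symm
  have hIeq : inertia v = (adicCompletionPrime ℚ v).inertia (absoluteGaloisGroup ℚ) :=
    (inertia_adicCompletionPrime_eq_map_absInertia ℚ v).symm
  haveI := compactSpace_decomp (K := ℚ) v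
  obtain ⟨b, hb⟩ := exists_eq_smul_sub_of_vanishing_on_inertia_of_surjective
    (G := decomp (K := ℚ) v) (D := (reductionDatum W p hpv hΔ).Gr) (p := p)
    (I := (inertia v).subgroupOf (decomp v)) (P := decompIn κ.kerSubgroup v)
    (fun g i hi ↦ by
      rw [Subgroup.mem_subgroupOf] at hi ⊢
      simp only [Subgroup.coe_mul, Subgroup.coe_inv]
      rw [hIeq] at hi ⊢
      exact GreenbergVatsalUnramifiedAway.conj_mem_inertia_of_mem_decompositionSubgroup _
        (hDeq ▸ g.2) hi)
    hφ₀P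
    (fun U hU d ↦ by
      obtain ⟨n, i, u, hi, hu, hd⟩ := exists_eq_frob_pow_mul_of_decomp v (specVal_spec v) h𝔐 hτ U hU d
      exact ⟨n, i, u, (Subgroup.mem_subgroupOf).2 hi, hu, hd⟩)
    (κ.toContinuousMonoidHom.toMonoidHom.comp (decomp v).subtype)
    (fun {x} ↦ by
      rw [mem_decompIn_iff, ZpExtension.mem_kerSubgroup]; rfl)
    (fun U hUn hU ↦ by
      haveI := hUn
      obtain ⟨B, hB⟩ := exists_layer_le_kappa_inertia κ v hκ hpv U hU
      refine ⟨B, fun u hu ↦ ?_⟩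
      obtain ⟨w, hwU, hwI, hκw⟩ := hB u hu
      exact ⟨w, hwU, (Subgroup.mem_subgroupOf).2 hwI, hκw⟩)
    (fun B ↦ exists_open_layer κ v B)
    (continuous_smul_gr W p hpv hΔ)
    (fun i hi d ↦ smul_gr_eq_of_mem_inertia W p hpv hΔ ((Subgroup.mem_subgroupOf).1 hi) d)
    (exists_frob_smul_sub_eq W p hpv hΔ hord h𝔐 hτ)
    (contOneCocycles.pullback (decompInToH κ.kerSubgroup v)
      (resHomOfEquivariant _ (reductionDatum W p hpv hΔ).grMk fun _ _ ↦ rfl) f)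
    (fun x hxI ↦ by
      rw [contOneCocycles.pullback_apply]
      have hxH : ((x : decomp (K := ℚ) v) : absoluteGaloisGroup ℚ) ∈ κ.kerSubgroup :=
        (mem_decompIn_iff κ.kerSubgroup v _).1 x.2
      set x' : inertiaIn κ.kerSubgroup v := ⟨(x : decomp (K := ℚ) v),
        (mem_inertiaIn_iff κ.kerSubgroup v _).2 ⟨hxH, (Subgroup.mem_subgroupOf).1 hxI⟩⟩ with hx'
      have h := hq x'
      have e1 : inertiaInToH κ.kerSubgroup v x' = decompInToH κ.kerSubgroup v x := Subtype.ext rfl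
      have e2 : x' • q - q = 0 := by
        rw [sub_eq_zero, Subgroup.smul_def]
        exact smul_gr_eq_of_mem_inertia W p hpv hΔ ((Subgroup.mem_subgroupOf).1 hxI) q
      rw [e1, e2] at h
      exact h)
  exact ⟨b, fun x ↦ hb x⟩

/-- **The two local conditions at `p` COINCIDE over `ℚ_∞^{cyc}` for Greenberg's datum** at a good
ordinary `p`: `greenbergKer = strictKer`. [cite: GreenbergLNM1716, §2 pp. 73–74]
[cite: Greenberg1989, §1 p. 98] -/
theorem greenbergKer_eq_strictKer (hκ : κ.IsCyclotomic) (hpv : ((p : ℕ) : 𝓞 ℚ) ∈ v.asIdeal)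
    (hΔ : ¬ (p : ℤ) ∣ W.minimalDiscriminantInt) (hord : ¬ (p : ℤ) ∣ W.frobeniusTrace p) :
    (reductionDatum W p hpv hΔ).greenbergKer κ.kerSubgroup =
      (reductionDatum W p hpv hΔ).strictKer κ.kerSubgroup :=
  le_antisymm (greenbergKer_le_strictKer W p κ hκ hpv hΔ hord)
    ((reductionDatum W p hpv hΔ).strictKer_le_greenbergKer κ.kerSubgroup)

/-- **All three local conditions at `p` coincide over `ℚ_∞^{cyc}` modulo the printed `L_𝔭 ⊆ im κ_𝔭`**:
for Greenberg's datum at a good ordinary `p`, the Kummer condition (`WeierstrassCurve.localKerOver`,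
`im κ_𝔭`), Greenberg's inertia-form condition (`greenbergKer`, GV's `L_𝔭`) and the strict
condition (`strictKer`, Greenberg's `Im λ`) are EQUAL — `⊆` of the first in the second is gen 9's
kernel theorem (`GreenbergVatsalSelmerLink.localKerOver_le_greenbergKer` + `reductionData_kummer`),
the second equals the third by `greenbergKer_eq_strictKer`, and the second `⊆` the first is the cited
`GreenbergVatsal2000.imKummer_ge_greenbergCondition_at_p` (hypothesis `hGV`).
[cite: GreenbergLNM1716, §2 Props. 2.2, 2.4 (pp. 73–75)] [cite: GreenbergVatsal2000, §2 p. 26] -/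
theorem localKerOver_eq_greenbergKer_and_strictKer
    (hGV : Literature.NumberTheory.EllipticCurves.GreenbergVatsal2000.imKummer_ge_greenbergCondition_at_p)
    (hκ : κ.IsCyclotomic) (hpv : ((p : ℕ) : 𝓞 ℚ) ∈ v.asIdeal)
    (hΔ : ¬ (p : ℤ) ∣ W.minimalDiscriminantInt) (hord : ¬ (p : ℤ) ∣ W.frobeniusTrace p) :
    W.localKerOver p κ.kerSubgroup (v.adicCompletion ℚ) =
        (reductionDatum W p hpv hΔ).greenbergKer κ.kerSubgroup ∧
      W.localKerOver p κ.kerSubgroup (v.adicCompletion ℚ) =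
        (reductionDatum W p hpv hΔ).strictKer κ.kerSubgroup := by
  have h1 : W.localKerOver p κ.kerSubgroup (v.adicCompletion ℚ) =
      (reductionDatum W p hpv hΔ).greenbergKer κ.kerSubgroup :=
    le_antisymm
      (GreenbergVatsalSelmerLink.localKerOver_le_greenbergKer W p κ.kerSubgroup
        (reductionDatum W p hpv hΔ) (reductionDatum_kummer W p hpv hΔ))
      (GreenbergVatsalSelmerEqualityCited.greenbergKer_reductionData_le_localKerOver W p κ hGV hΔ
        hord hκ v hpv)
  exact ⟨h1, h1.trans (greenbergKer_eq_strictKer W p κ hκ hpv hΔ hord)⟩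

end Main

end Summit.BirchSwinnertonDyer.Rank1Residual.X2.GreenbergVatsalStrictAtP

end
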